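import Literature.AlgebraicGeometry.Milne1999.HodgeGroupProductsPowers
import Literature.AlgebraicGeometry.Milne1999.HodgeGroupIsogeny
import Literature.AlgebraicGeometry.HodgeTheory.HodgeClassesProductSpanTransport
import Literature.AlgebraicGeometry.HodgeTheory.HodgeConjectureIsogenyInvariance
import HarnessLib

/-!
# The splitting `Hg(X_1 × X_2) = Hg(X_1) × Hg(X_2)` depends only on the isogeny classes of the factors up to
# powers, and is symmetric (Moonen–Zarhin 1999, §1 and (3.1); Milne 1999, §1; van Geemen LNM 1594, 3.6–3.7)

Family `hodge`, layer `Literature/AlgebraicGeometry/Milne1999`; THEOREMS ONLY — no definition, no named fact, no `sorry`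
(D-0026, net debt 0). Lane `lit-hodgefound` (Track 2 foundations library), prover seat `lit-hodgefound-p21`, generation 31,
row g31-#8; sequel of the lane's `HodgeGroupProductsSplitting` / `HodgeGroupProductsPowers` (Moonen–Zarhin (3.1)
Tannaka-free: splitting ⟺ product span on all pairs of powers) and of `HodgeTheory/HodgeClassesProductSpanTransport`
(product span along isogenies, subvarieties, quotients).

PUBLISHED STATEMENTS (held `paper:arxiv-math_9901113`, re-read this session). B. Moonen, Yu. G. Zarhin, Math. Ann. 315
(1999), (3.1) (chunk p0006 L24–L62): «Let `X_1` and `X_2` be complex abelian varieties. Write `X = X_1 × X_2`. Then `Hg(X)` is an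
algebraic subgroup of `Hg(X_1) × Hg(X_2)` … `Hg(X_1 × X_2) ≠ Hg(X_1) × Hg(X_2)` (1) … This holds if and only if for some `m` and
`n` the Hodge ring `B•(X_1^m × X_2^n)` is not generated by the elements coming from `B•(X_1^m)` and `B•(X_2^n)`»; §1 (p0002
L138–L141): «we can identify `Hg(X_1^{n_1} × ⋯ × X_r^{n_r})` with `Hg(X_1 × ⋯ × X_r)`». J. S. Milne, Duke Math. J. 96
(1999), §1 (Prop. 1.1 / 1.5): «Any such isogeny induces an isomorphism … which is independent of the choice of the isogeny».
B. van Geemen, LNM 1594, 3.6–3.7: an isogeny induces isomorphisms `Bᵖ(X) → Bᵖ(Y)`.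

THE SPLITTING PREDICATE, on the tree's carriers (no definition is introduced; it is spelled out in every statement):
`SPLIT(B, C) :≡ ∀ u ∈ Hg(B)(ℂ)|_{H¹}, ∀ v ∈ Hg(C)(ℂ)|_{H¹}, ⋀•(u ⊕ v) ∈ Hg(B × C)(ℂ)` — together with the lane's
`Hg(B × C) ≤ Hg(B) × Hg(C)` (`exists_eq_prodBlockDiagEquiv_of_mem_hodgeGroup_prod`) this is «`Hg(X_1 × X_2) = Hg(X_1) × Hg(X_2)`».

WHAT IS PROVED:
* §1 **ISOGENY INVARIANCE IN EACH FACTOR**: `forall_prodBlockDiagEquiv_mem_hodgeGroup_of_isIsogenous` (`B' ∼ B`, `C' ∼ C`,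
  `SPLIT(B, C) ⟹ SPLIT(B', C')`), `…_of_isIsogenous'` (the isogenies pointing the other way) and
  **`forall_prodBlockDiagEquiv_mem_hodgeGroup_iff_of_isIsogenous`** — through Moonen–Zarhin (3.1) for all exponents
  (`forall_prodBlockDiagEquiv_mem_hodgeGroup_iff_forall_hodgeClassesProductSpan_powSucc_powSucc`), powers of isogenies
  (g31-#1 `isIsogeny_powSuccMap`) and the isogeny invariance of the product span (`HodgeClassesProductSpan.of_isIsogenous`).
* §2 **SYMMETRY**: `forall_prodBlockDiagEquiv_mem_hodgeGroup_symm` (`SPLIT(B, C) ⟹ SPLIT(C, B)`) and `…_comm`, through the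
  symmetry of the product span (`HodgeClassesProductSpan.symm`).
* §3 **POWERS**: **`forall_prodBlockDiagEquiv_mem_hodgeGroup_powSucc_prod_powSucc_iff`** (`SPLIT(B^{r+1}, C^{s+1}) ⟺ SPLIT(B, C)`;
  `⟸` is the lane's `forall_prodBlockDiagEquiv_mem_hodgeGroup_powSucc_prod_powSucc`, `⟹` descends the product span along the
  retractions `B^{m+1} ⇄ (B^{r+1})^{m+1}` (`exists_retraction_powSucc_powSucc`, `HodgeClassesProductSpan.of_comp_eq_nsmul_id`)),
  and the combined form `forall_prodBlockDiagEquiv_mem_hodgeGroup_iff_of_isIsogenous_powSucc` (`B' ∼ B^{r+1}`, `C' ∼ C^{s+1}`).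
* §4 **CONSEQUENCES FOR THE HODGE CONJECTURE**: `hodgeClassesProductSpan_of_isIsogenous_powSucc_of_split` (for `B' ∼ B^{m+1}`,
  `C' ∼ C^{n+1}` and `SPLIT(B, C)`, the Hodge classes of `B' × C'` are spanned by products) and
  **`hodgeConjectureFor_of_isIsogenous_powSucc_prod_powSucc_of_split`** (`X ∼ B^{m+1} × C^{n+1}`, `SPLIT(B, C)`, `HC(B^{m+1})`,
  `HC(C^{n+1})` ⟹ `HC(X)`; a conditional implication, not a case of the summit statement).

HONESTY CLAUSE. Nothing is asserted about WHEN the Hodge group splits (that is Moonen–Zarhin's/Gordon's structure theory,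
vendored elsewhere as hypotheses); only the invariance of the splitting predicate under isogenies, swapping and powers.

## References

* [MoonenZarhin1999LowDim] B. Moonen, Yu. G. Zarhin, Math. Ann. 315 (1999), §1 and (3.1). [cite: MoonenZarhin1999LowDim, §1 and §3 (3.1)]
* [Milne1999LefschetzClasses] J. S. Milne, Duke Math. J. 96 (1999), §1 (Prop. 1.1, 1.5). [cite: Milne1999LefschetzClasses, §1 pp. 643–644]
* [vanGeemen1994HodgeAV] B. van Geemen, LNM 1594 (1994), 3.6–3.7. [cite: vanGeemen1994HodgeAV, §3.6–3.7 (p. 236)]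
* [MumfordAV1970] D. Mumford, Abelian Varieties (1970), §19 Thm. 1 and Remark p. 169. [cite: MumfordAV1970, §19 Remark p. 169]
-/

noncomputable section

open CategoryTheory
open Literature.AlgebraicTopology.SingularHomology
open Literature.AlgebraicGeometry.HodgeTheory
open Literature.AlgebraicGeometry.Motives
open Literature.AlgebraicGeometry.VanGeemen1994 (hodgeGroupOne mem_hodgeGroupOne_iff)

namespace Literature.AlgebraicGeometry.Milne1999

variable {B B' C C' : AbelianVariety ℂ}

/-! ### §1 Isogeny invariance in each factor -/

section Isogeny

/-- **`Hg(B × C) = Hg(B) × Hg(C)` passes to isogenous factors** (`B' ∼ B`, `C' ∼ C`): by Moonen–Zarhin (3.1) the splitting is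
equivalent to «`B•(B^{m+1} × C^{n+1})` is generated by the classes coming from the factors» for all `m`, `n`; powers of
isogenies are isogenies and the product span is an isogeny invariant of the two factors.
[cite: MoonenZarhin1999LowDim, §3 (3.1)] [cite: Milne1999LefschetzClasses, §1 Prop. 1.1 and 1.5] [cite: vanGeemen1994HodgeAV, §3.6–3.7 (p. 236)] -/
theorem forall_prodBlockDiagEquiv_mem_hodgeGroup_of_isIsogenous (hB : AbelianVariety.IsIsogenous B' B)
    (hC : AbelianVariety.IsIsogenous C' C)
    (h : ∀ u ∈ hodgeGroupOne B.dim B.X, ∀ v ∈ hodgeGroupOne C.dim C.X,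
      (fun k ↦ exteriorPullbackEquiv (AbelianVariety.hasExteriorCohomologyH1_complexPoints (B.prod C)) (prodBlockDiagEquiv u v) k) ∈
        hodgeGroup (B.prod C).dim (B.prod C).X) :
    ∀ u ∈ hodgeGroupOne B'.dim B'.X, ∀ v ∈ hodgeGroupOne C'.dim C'.X,
      (fun k ↦ exteriorPullbackEquiv (AbelianVariety.hasExteriorCohomologyH1_complexPoints (B'.prod C')) (prodBlockDiagEquiv u v) k) ∈
        hodgeGroup (B'.prod C').dim (B'.prod C').X := by
  obtain ⟨f, hf⟩ := hB
  obtain ⟨g, hg⟩ := hC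
  rw [forall_prodBlockDiagEquiv_mem_hodgeGroup_iff_forall_hodgeClassesProductSpan_powSucc_powSucc] at h ⊢
  intro m n
  exact (h m n).of_isIsogenous ⟨powSuccMap f m, isIsogeny_powSuccMap hf m⟩ ⟨powSuccMap g n, isIsogeny_powSuccMap hg n⟩

/-- The same with the isogenies pointing the other way (`B ∼ B'`, `C ∼ C'`; isogeny is symmetric over `ℂ`,
`AbelianVariety.IsIsogenous.symm_of_charZero`). [cite: MoonenZarhin1999LowDim, §3 (3.1)] [cite: MumfordAV1970, §19 Remark p. 169] -/
theorem forall_prodBlockDiagEquiv_mem_hodgeGroup_of_isIsogenous' (hB : AbelianVariety.IsIsogenous B B')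
    (hC : AbelianVariety.IsIsogenous C C')
    (h : ∀ u ∈ hodgeGroupOne B.dim B.X, ∀ v ∈ hodgeGroupOne C.dim C.X,
      (fun k ↦ exteriorPullbackEquiv (AbelianVariety.hasExteriorCohomologyH1_complexPoints (B.prod C)) (prodBlockDiagEquiv u v) k) ∈
        hodgeGroup (B.prod C).dim (B.prod C).X) :
    ∀ u ∈ hodgeGroupOne B'.dim B'.X, ∀ v ∈ hodgeGroupOne C'.dim C'.X,
      (fun k ↦ exteriorPullbackEquiv (AbelianVariety.hasExteriorCohomologyH1_complexPoints (B'.prod C')) (prodBlockDiagEquiv u v) k) ∈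
        hodgeGroup (B'.prod C').dim (B'.prod C').X :=
  forall_prodBlockDiagEquiv_mem_hodgeGroup_of_isIsogenous (AbelianVariety.IsIsogenous.symm_of_charZero hB)
    (AbelianVariety.IsIsogenous.symm_of_charZero hC) h

/-- **The splitting of `Hg(B × C)` depends only on the isogeny classes of `B` and `C`.**
[cite: MoonenZarhin1999LowDim, §3 (3.1)] [cite: Milne1999LefschetzClasses, §1 Prop. 1.1 and 1.5] -/
theorem forall_prodBlockDiagEquiv_mem_hodgeGroup_iff_of_isIsogenous (hB : AbelianVariety.IsIsogenous B' B)
    (hC : AbelianVariety.IsIsogenous C' C) :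
    (∀ u ∈ hodgeGroupOne B'.dim B'.X, ∀ v ∈ hodgeGroupOne C'.dim C'.X,
      (fun k ↦ exteriorPullbackEquiv (AbelianVariety.hasExteriorCohomologyH1_complexPoints (B'.prod C')) (prodBlockDiagEquiv u v) k) ∈
        hodgeGroup (B'.prod C').dim (B'.prod C').X) ↔
    ∀ u ∈ hodgeGroupOne B.dim B.X, ∀ v ∈ hodgeGroupOne C.dim C.X,
      (fun k ↦ exteriorPullbackEquiv (AbelianVariety.hasExteriorCohomologyH1_complexPoints (B.prod C)) (prodBlockDiagEquiv u v) k) ∈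
        hodgeGroup (B.prod C).dim (B.prod C).X :=
  ⟨forall_prodBlockDiagEquiv_mem_hodgeGroup_of_isIsogenous' hB hC, forall_prodBlockDiagEquiv_mem_hodgeGroup_of_isIsogenous hB hC⟩

end Isogeny

/-! ### §2 Symmetry -/

section Symmetry

variable (B C)

/-- **`Hg(B × C)` splits iff `Hg(C × B)` splits** (direction `⟹`): through (3.1) for all exponents and the symmetry of the
product span `B•(B^{m+1} × C^{n+1})` ↔ `B•(C^{n+1} × B^{m+1})` (`HodgeClassesProductSpan.symm`).
[cite: MoonenZarhin1999LowDim, §3 (3.1)] -/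
theorem forall_prodBlockDiagEquiv_mem_hodgeGroup_symm
    (h : ∀ u ∈ hodgeGroupOne B.dim B.X, ∀ v ∈ hodgeGroupOne C.dim C.X,
      (fun k ↦ exteriorPullbackEquiv (AbelianVariety.hasExteriorCohomologyH1_complexPoints (B.prod C)) (prodBlockDiagEquiv u v) k) ∈
        hodgeGroup (B.prod C).dim (B.prod C).X) :
    ∀ v ∈ hodgeGroupOne C.dim C.X, ∀ u ∈ hodgeGroupOne B.dim B.X,
      (fun k ↦ exteriorPullbackEquiv (AbelianVariety.hasExteriorCohomologyH1_complexPoints (C.prod B)) (prodBlockDiagEquiv v u) k) ∈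
        hodgeGroup (C.prod B).dim (C.prod B).X := by
  rw [forall_prodBlockDiagEquiv_mem_hodgeGroup_iff_forall_hodgeClassesProductSpan_powSucc_powSucc] at h ⊢
  exact fun n m ↦ (h m n).symm

/-- **`Hg(B × C)` splits iff `Hg(C × B)` splits.** [cite: MoonenZarhin1999LowDim, §3 (3.1)] -/
theorem forall_prodBlockDiagEquiv_mem_hodgeGroup_comm :
    (∀ u ∈ hodgeGroupOne B.dim B.X, ∀ v ∈ hodgeGroupOne C.dim C.X,
      (fun k ↦ exteriorPullbackEquiv (AbelianVariety.hasExteriorCohomologyH1_complexPoints (B.prod C)) (prodBlockDiagEquiv u v) k) ∈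
        hodgeGroup (B.prod C).dim (B.prod C).X) ↔
    ∀ v ∈ hodgeGroupOne C.dim C.X, ∀ u ∈ hodgeGroupOne B.dim B.X,
      (fun k ↦ exteriorPullbackEquiv (AbelianVariety.hasExteriorCohomologyH1_complexPoints (C.prod B)) (prodBlockDiagEquiv v u) k) ∈
        hodgeGroup (C.prod B).dim (C.prod B).X :=
  ⟨forall_prodBlockDiagEquiv_mem_hodgeGroup_symm B C, forall_prodBlockDiagEquiv_mem_hodgeGroup_symm C B⟩

end Symmetry

/-! ### §3 Powers -/

section Powers

variable (B C)

/-- **The product span descends from `(B^{r+1})^{m+1} × (C^{s+1})^{n+1}` to `B^{m+1} × C^{n+1}`** along the retractions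
`B^{m+1} ⇄ (B^{r+1})^{m+1}`, `C^{n+1} ⇄ (C^{s+1})^{n+1}` (blockwise factor inclusions / projections,
`exists_retraction_powSucc_powSucc`; the product span passes to direct summands, `HodgeClassesProductSpan.of_comp_eq_nsmul_id`).
[cite: MoonenZarhin1999LowDim, §3 (3.1)] [cite: MumfordAV1970, §19 Thm. 1 (pp. 173–174)] -/
theorem hodgeClassesProductSpan_powSucc_powSucc_of_powSucc_powSucc_powSucc (r s m n : ℕ)
    (h : HodgeClassesProductSpan ((B.powSucc r).powSucc m) ((C.powSucc s).powSucc n)) :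
    HodgeClassesProductSpan (B.powSucc m) (C.powSucc n) := by
  obtain ⟨ι, π, hιπ⟩ := exists_retraction_powSucc_powSucc B r m
  obtain ⟨ι', π', hιπ'⟩ := exists_retraction_powSucc_powSucc C s n
  exact h.of_comp_eq_nsmul_id ι π one_ne_zero (by rw [hιπ, one_nsmul]) ι' π' one_ne_zero (by rw [hιπ', one_nsmul])

/-- **`Hg(B^{r+1} × C^{s+1})` splits iff `Hg(B × C)` splits** («we can identify `Hg(X_1^{n_1} × X_2^{n_2})` with
`Hg(X_1 × X_2)`», compatibly with the product decomposition): `⟸` is the lane's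
`forall_prodBlockDiagEquiv_mem_hodgeGroup_powSucc_prod_powSucc`; `⟹` through (3.1) for all exponents, descending the product
span from `(B^{r+1})^{m+1} × (C^{s+1})^{n+1}` to `B^{m+1} × C^{n+1}`.
[cite: MoonenZarhin1999LowDim, §1 and §3 (3.1)] [cite: Milne1999LefschetzClasses, §1 p. 643] -/
theorem forall_prodBlockDiagEquiv_mem_hodgeGroup_powSucc_prod_powSucc_iff (r s : ℕ) :
    (∀ u ∈ hodgeGroupOne (B.powSucc r).dim (B.powSucc r).X, ∀ v ∈ hodgeGroupOne (C.powSucc s).dim (C.powSucc s).X,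
      (fun k ↦ exteriorPullbackEquiv (AbelianVariety.hasExteriorCohomologyH1_complexPoints ((B.powSucc r).prod (C.powSucc s)))
        (prodBlockDiagEquiv u v) k) ∈ hodgeGroup ((B.powSucc r).prod (C.powSucc s)).dim ((B.powSucc r).prod (C.powSucc s)).X) ↔
    ∀ u ∈ hodgeGroupOne B.dim B.X, ∀ v ∈ hodgeGroupOne C.dim C.X,
      (fun k ↦ exteriorPullbackEquiv (AbelianVariety.hasExteriorCohomologyH1_complexPoints (B.prod C)) (prodBlockDiagEquiv u v) k) ∈
        hodgeGroup (B.prod C).dim (B.prod C).X := by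
  refine ⟨fun h ↦ ?_, fun h ↦ forall_prodBlockDiagEquiv_mem_hodgeGroup_powSucc_prod_powSucc B C h r s⟩
  rw [forall_prodBlockDiagEquiv_mem_hodgeGroup_iff_forall_hodgeClassesProductSpan_powSucc_powSucc] at h ⊢
  exact fun m n ↦ hodgeClassesProductSpan_powSucc_powSucc_of_powSucc_powSucc_powSucc B C r s m n (h m n)

variable {B C}

/-- **The splitting of `Hg(B' × C')` for `B' ∼ B^{r+1}`, `C' ∼ C^{s+1}` is that of `Hg(B × C)`** (isogeny classes up to
powers of the factors). [cite: MoonenZarhin1999LowDim, §1 and §3 (3.1)] [cite: Milne1999LefschetzClasses, §1 Prop. 1.1 and 1.5] -/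
theorem forall_prodBlockDiagEquiv_mem_hodgeGroup_iff_of_isIsogenous_powSucc {r s : ℕ}
    (hB : AbelianVariety.IsIsogenous B' (B.powSucc r)) (hC : AbelianVariety.IsIsogenous C' (C.powSucc s)) :
    (∀ u ∈ hodgeGroupOne B'.dim B'.X, ∀ v ∈ hodgeGroupOne C'.dim C'.X,
      (fun k ↦ exteriorPullbackEquiv (AbelianVariety.hasExteriorCohomologyH1_complexPoints (B'.prod C')) (prodBlockDiagEquiv u v) k) ∈
        hodgeGroup (B'.prod C').dim (B'.prod C').X) ↔
    ∀ u ∈ hodgeGroupOne B.dim B.X, ∀ v ∈ hodgeGroupOne C.dim C.X,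
      (fun k ↦ exteriorPullbackEquiv (AbelianVariety.hasExteriorCohomologyH1_complexPoints (B.prod C)) (prodBlockDiagEquiv u v) k) ∈
        hodgeGroup (B.prod C).dim (B.prod C).X :=
  (forall_prodBlockDiagEquiv_mem_hodgeGroup_iff_of_isIsogenous hB hC).trans
    (forall_prodBlockDiagEquiv_mem_hodgeGroup_powSucc_prod_powSucc_iff B C r s)

end Powers

/-! ### §4 Consequences for the Hodge classes and the Hodge conjecture on the isogeny class -/

section Consequences

/-- **Product span throughout the isogeny classes of the powers**: if `Hg(B × C)` splits, then for `B' ∼ B^{m+1}` and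
`C' ∼ C^{n+1}` the rational `(p,p)`-classes of `B' × C'` are spanned by exterior products of Hodge classes of `B'` and `C'`
(Moonen–Zarhin (3.1) `⟹` for all exponents, then isogeny invariance of the product span).
[cite: MoonenZarhin1999LowDim, §3 (3.1)] [cite: vanGeemen1994HodgeAV, §3.6–3.7 (p. 236)] -/
theorem hodgeClassesProductSpan_of_isIsogenous_powSucc_of_split {m n : ℕ}
    (h : ∀ u ∈ hodgeGroupOne B.dim B.X, ∀ v ∈ hodgeGroupOne C.dim C.X,
      (fun k ↦ exteriorPullbackEquiv (AbelianVariety.hasExteriorCohomologyH1_complexPoints (B.prod C)) (prodBlockDiagEquiv u v) k) ∈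
        hodgeGroup (B.prod C).dim (B.prod C).X)
    (hB : AbelianVariety.IsIsogenous B' (B.powSucc m)) (hC : AbelianVariety.IsIsogenous C' (C.powSucc n)) :
    HodgeClassesProductSpan B' C' :=
  (hodgeClassesProductSpan_powSucc_powSucc_of_forall_prodBlockDiagEquiv_mem_hodgeGroup B C h m n).of_isIsogenous hB hC

/-- **The Hodge conjecture on the isogeny class of `B^{m+1} × C^{n+1}` under splitting**: if `Hg(B × C)` splits and the Hodge
conjecture holds for `B^{m+1}` and for `C^{n+1}`, then it holds for every `X` isogenous to `B^{m+1} × C^{n+1}` (the lane's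
`hodgeConjectureFor_powSucc_prod_powSucc_of_forall_prodBlockDiagEquiv_mem'` and van Geemen's Lemma 3.7,
`HodgeConjectureFor.of_isIsogenous`). A conditional implication, not a case of the summit statement.
[cite: MoonenZarhin1999LowDim, §3 (3.1)] [cite: vanGeemen1994HodgeAV, §3.5–3.7 Lemma 3.7 (p. 236)] -/
theorem hodgeConjectureFor_of_isIsogenous_powSucc_prod_powSucc_of_split {X : AbelianVariety ℂ} {m n : ℕ}
    (h : ∀ u ∈ hodgeGroupOne B.dim B.X, ∀ v ∈ hodgeGroupOne C.dim C.X,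
      (fun k ↦ exteriorPullbackEquiv (AbelianVariety.hasExteriorCohomologyH1_complexPoints (B.prod C)) (prodBlockDiagEquiv u v) k) ∈
        hodgeGroup (B.prod C).dim (B.prod C).X)
    (hX : AbelianVariety.IsIsogenous X ((B.powSucc m).prod (C.powSucc n)))
    (hBm : HodgeConjectureFor (B.powSucc m).dim (B.powSucc m).X) (hCn : HodgeConjectureFor (C.powSucc n).dim (C.powSucc n).X) :
    HodgeConjectureFor X.dim X.X :=
  HodgeConjectureFor.of_isIsogenous hX
    (hodgeConjectureFor_powSucc_prod_powSucc_of_forall_prodBlockDiagEquiv_mem' B C h m n hBm hCn)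

end Consequences

end Literature.AlgebraicGeometry.Milne1999

end
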